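import Summits.ResolutionOfSingularities.ResolutionOfSingularities.Theorems.FrobeniusLadderFRationalResolutionFRationalCM
import Summits.ResolutionOfSingularities.ResolutionOfSingularities.Theorems.FrobeniusLadderFRationalResolutionStalkPresentation
import Summits.ResolutionOfSingularities.ResolutionOfSingularities.Theorems.FrobeniusLadderFRationalResolutionFrobeniusClosedOfClause
import Summits.ResolutionOfSingularities.ResolutionOfSingularities.Theorems.FrobeniusLadderFRationalResolutionStubClauseOfRingEquiv
import Summits.ResolutionOfSingularities.ResolutionOfSingularities.Theorems.FrobeniusLadderFRationalResolutionStubRungsOfSummit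
import Mathlib.RingTheory.RegularLocalRing.Polynomial
import Mathlib.AlgebraicGeometry.Morphisms.Proper
import HarnessLib

/-!
# The Frobenius ladder is monotone: F-rational models are Cohen–Macaulay and F-injective
# (rung 3 ⇒ rung 2), for schemes of finite type over a field

Route `FrobeniusLadder`, crux stmt-ResolutionOfSingularities-15317 `FRationalResolution`, line
`Sketch`. The route climbs `FInjectiveMacaulayfication` (rung 2: a proper birational model whose
stalks are domains in which every system of parameters is a weakly regular sequence generating a
Frobenius-closed ideal) → `FRationalModification` (rung 3: stalks domains with every parameter ideal
tightly closed) → `FRationalResolution` (rung 4). This file proves, for every scheme `X` locally of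
finite type over a field `k` of characteristic `p`, that the rung-3 stalk clause IMPLIES the rung-2
stalk clause (`rungTwoClause_of_fRationalClause`): Hochster–Huneke 1994, Thm. 4.2 (c) "F-rational ⇒
Cohen–Macaulay" (ring level: `isWeaklyRegular_of_fRational_clause_quotient`, colon capturing in a
regular local presentation `𝒪_{X,x} ≅ k[T]_P / Q` from `exists_stalk_ringEquiv_quotient`) together
with "tightly closed ⇒ Frobenius closed" (`frobeniusClosed_sop_of_fRational_clause`). Consequently
every F-rational model in the sense of crux 15317 is a model in the sense of the HYPOTHESIS of crux
15316 (`fRationalModel_isFInjectiveCMModel`): the ladder's classes are nested as the thesis says.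
-/

-- single-problem summit: the doubled namespace component `ResolutionOfSingularities` is forced
set_option linter.dupNamespace false

noncomputable section

open CategoryTheory AlgebraicGeometry TopologicalSpace
open Literature.AlgebraicGeometry.Resolution

namespace Summit.ResolutionOfSingularities.ResolutionOfSingularities.Theorems.FRationalResolution

/-- **Rung 3 ⇒ rung 2, ring level with a presentation.** Let `O` be a ring of prime
characteristic `p` isomorphic to a quotient `S ⧸ Q` of a regular local ring `S` of characteristic
`p`. If `O` is a domain in which every ideal generated by a system of parameters is tightly closed
(inline clause), then every system of parameters of `O` is a weakly regular sequence and generates a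
Frobenius-closed ideal (Hochster–Huneke 1994, Thm. 4.2 (c); Fedder–Watanabe 1989, Rem. 1.9). -/
theorem rungTwoClause_of_presentation (p : ℕ) (hp : p.Prime) (O : Type) [CommRing O] [CharP O p]
    (S : Type) [CommRing S] [IsRegularLocalRing S] [CharP S p] (Q : Ideal S) (e : O ≃+* S ⧸ Q)
    (hFR : IsDomain O ∧ ∀ d : ℕ, ringKrullDim O = d → ∀ s : Fin d → O,
      (Ideal.span (Set.range s)).radical.IsMaximal → ∀ y c : O, c ≠ 0 →
      (∀ e : ℕ, c * y ^ p ^ e ∈ Ideal.span ((fun z : O => z ^ p ^ e) ''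
        (Ideal.span (Set.range s) : Set O))) → y ∈ Ideal.span (Set.range s)) :
    IsDomain O ∧ ∀ d : ℕ, ringKrullDim O = d → ∀ s : Fin d → O,
      (Ideal.span (Set.range s)).radical.IsMaximal →
      RingTheory.Sequence.IsWeaklyRegular O (List.ofFn s) ∧
      ∀ y : O, (∃ e : ℕ, y ^ p ^ e ∈ Ideal.span ((fun z : O => z ^ p ^ e) ''
        (Ideal.span (Set.range s) : Set O))) → y ∈ Ideal.span (Set.range s) := by
  classical
  haveI : Fact p.Prime := ⟨hp⟩
  -- transport the F-rational clause to `S ⧸ Q`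
  have hcl := ClauseInvariance.stub_clause_of_ringEquiv p e hFR
  haveI : IsDomain (S ⧸ Q) := hcl.1
  haveI hQ : Q.IsPrime := (Ideal.Quotient.isDomain_iff_prime Q).mp hcl.1
  refine ⟨hFR.1, fun d hd s hs => ⟨?_, ?_⟩⟩
  · -- Cohen–Macaulay: colon capturing in the presentation, transported back along `e`
    have hd' : ringKrullDim (S ⧸ Q) = d := by
      rw [← ringKrullDim_eq_of_ringEquiv e]; exact hd
    have hspan : Ideal.span (Set.range (e ∘ s)) = (Ideal.span (Set.range s)).comap e.symm := by
      rw [Ideal.comap_symm, Set.range_comp, Ideal.map_span]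
    have hs' : (Ideal.span (Set.range (e ∘ s))).radical.IsMaximal := by
      haveI := hs
      rw [hspan, ← Ideal.comap_radical]
      infer_instance
    have hW := isWeaklyRegular_of_fRational_clause_quotient p S Q hcl.2 hd' (e ∘ s) hs'
    refine (AddEquiv.isWeaklyRegular_congr (e := e.toAddEquiv) (as := List.ofFn s)
      (bs := List.ofFn (e ∘ s)) ?_).mpr hW
    rw [← List.map_ofFn]
    refine List.forall₂_map_right_iff.mpr (List.forall₂_same.mpr fun r _ z => ?_)
    change e (r * z) = e r * e z
    exact map_mul e r z
  · -- Frobenius closed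
    exact frobeniusClosed_sop_of_fRational_clause p hp hFR d hd s hs

/-- **Rung 3 ⇒ rung 2 at every stalk** (Hochster–Huneke 1994, Thm. 4.2 (c) + Fedder–Watanabe 1989,
Rem. 1.9). Let `X` be locally of finite type over a field `k` of prime characteristic `p`, and
suppose every stalk is a domain in which every ideal generated by a system of parameters is tightly
closed (inline clause of `FRationalModification`/`FRationalResolution`). Then at every point the stalk
is a domain in which every system of parameters is a weakly regular sequence (Cohen–Macaulay) whose
ideal is Frobenius closed — the stalk clause of `FInjectiveMacaulayfication`. The stalk is presented
as `k[T]_P / Q` (`exists_stalk_ringEquiv_quotient`), `k[T]_P` being a regular local ring of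
characteristic `p`. -/
theorem rungTwoClause_of_fRationalClause (p : ℕ) (hp : p.Prime) (k : Type) [Field k] [CharP k p]
    (X : Scheme.{0}) (f : X ⟶ Spec (.of k)) [LocallyOfFiniteType f]
    (hFR : ∀ x : X, IsDomain (X.presheaf.stalk x) ∧ ∀ d : ℕ, ringKrullDim (X.presheaf.stalk x) = d →
      ∀ s : Fin d → X.presheaf.stalk x, (Ideal.span (Set.range s)).radical.IsMaximal →
      ∀ y c : X.presheaf.stalk x, c ≠ 0 →
      (∀ e : ℕ, c * y ^ p ^ e ∈ Ideal.span ((fun z : X.presheaf.stalk x => z ^ p ^ e) ''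
        (Ideal.span (Set.range s) : Set (X.presheaf.stalk x)))) → y ∈ Ideal.span (Set.range s))
    (x : X) :
    IsDomain (X.presheaf.stalk x) ∧ ∀ d : ℕ, ringKrullDim (X.presheaf.stalk x) = d →
      ∀ s : Fin d → X.presheaf.stalk x, (Ideal.span (Set.range s)).radical.IsMaximal →
      RingTheory.Sequence.IsWeaklyRegular (X.presheaf.stalk x) (List.ofFn s) ∧
      ∀ y : X.presheaf.stalk x, (∃ e : ℕ, y ^ p ^ e ∈ Ideal.span
        ((fun z : X.presheaf.stalk x => z ^ p ^ e) ''
          (Ideal.span (Set.range s) : Set (X.presheaf.stalk x)))) → y ∈ Ideal.span (Set.range s) := by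
  -- a regular local presentation of the stalk
  obtain ⟨n, P, hP, Q, ⟨e⟩⟩ := exists_stalk_ringEquiv_quotient k X f x
  haveI := hP
  haveI : IsRegularLocalRing (Localization.AtPrime P) :=
    IsRegularRing.isRegularLocalRing_localization P
  haveI : CharP (Localization.AtPrime P) p :=
    charP_of_injective_algebraMap (algebraMap k (Localization.AtPrime P)).injective p
  haveI : CharP (X.presheaf.stalk x) p := RungsOfSummit.charP_stalk_of_over hp.ne_zero k f x
  exact rungTwoClause_of_presentation p hp (X.presheaf.stalk x) (Localization.AtPrime P) Q e (hFR x)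

/-- **Every F-rational model is a Cohen–Macaulay F-injective model** (ladder monotonicity for the
transport-closed cruxes): if a separated finite-type `X/k` admits a proper birational model `X' → X`
whose stalks satisfy the clause of `FRationalResolution`'s hypothesis (rung 3), then the same model
satisfies the clause of `FRationalModification`'s hypothesis (rung 2: locally integral,
Cohen–Macaulay, parameter ideals Frobenius closed). -/
theorem fRationalModel_isFInjectiveCMModel (p : ℕ) (hp : p.Prime) (k : Type) [Field k] [CharP k p]
    (X : Scheme.{0}) (f : X ⟶ Spec (.of k)) [LocallyOfFiniteType f]
    (hmodel : ∃ (X' : Scheme.{0}) (π : X' ⟶ X), IsProper π ∧ IsBirational π ∧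
      ∀ x : X', IsDomain (X'.presheaf.stalk x) ∧ ∀ d : ℕ, ringKrullDim (X'.presheaf.stalk x) = d →
        ∀ s : Fin d → X'.presheaf.stalk x, (Ideal.span (Set.range s)).radical.IsMaximal →
        ∀ y c : X'.presheaf.stalk x, c ≠ 0 →
        (∀ e : ℕ, c * y ^ p ^ e ∈ Ideal.span ((fun z : X'.presheaf.stalk x => z ^ p ^ e) ''
          (Ideal.span (Set.range s) : Set (X'.presheaf.stalk x)))) → y ∈ Ideal.span (Set.range s)) :
    ∃ (X' : Scheme.{0}) (π : X' ⟶ X), IsProper π ∧ IsBirational π ∧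
      ∀ x : X', IsDomain (X'.presheaf.stalk x) ∧ ∀ d : ℕ, ringKrullDim (X'.presheaf.stalk x) = d →
        ∀ s : Fin d → X'.presheaf.stalk x, (Ideal.span (Set.range s)).radical.IsMaximal →
        RingTheory.Sequence.IsWeaklyRegular (X'.presheaf.stalk x) (List.ofFn s) ∧
        ∀ y : X'.presheaf.stalk x, (∃ e : ℕ, y ^ p ^ e ∈ Ideal.span
          ((fun z : X'.presheaf.stalk x => z ^ p ^ e) ''
            (Ideal.span (Set.range s) : Set (X'.presheaf.stalk x)))) → y ∈ Ideal.span (Set.range s) := by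
  obtain ⟨X', π, hπ, hbir, hFR⟩ := hmodel
  haveI := hπ
  exact ⟨X', π, hπ, hbir, rungTwoClause_of_fRationalClause p hp k X' (π ≫ f) hFR⟩

end Summit.ResolutionOfSingularities.ResolutionOfSingularities.Theorems.FRationalResolution

end
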